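import Summits.QuantumFields.YangMills.Theorems.ColdStartUniversalityLatticeLangevinDynkinCellMartingale
import Summits.QuantumFields.YangMills.Theorems.ColdStartUniversalityLatticeLangevinItoProcessMoments
import HarnessLib

/-!
# Route `ColdStartUniversality`, rung `stub_fixedCutoffMixing` of K_A1 (stmt-QuantumFields-24809):
# the Taylor decomposition of one cell

Helper file (seat `ym-line-csu-p1`, g6) for the `WilsonMeasureLangevinInvariant` wall of the rung
(step 2, Taylor route to Dynkin's formula in expectation for a vector Itô process
`X_t^i = X_0^i + ∫₀ᵗ bⁱ dr + ∑_k ∫₀ᵗ σ^{ik} dW^k` with bounded progressive coefficients, JOINT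
filtration of the Brownian vector `W`).  For a cell `(u, v]`, a bounded `𝓕_u`-measurable weight `Z`
and second-order Taylor data `(f, g = ∇f, h = ∇²f)` the error

  `E[Z (f(X_v) - f(X_u))] - E[Z ∫_{(u,v]} (Lf)_r dr]`,
  `(Lf)_r = ∑_i g_i(X_r) b^i_r + ½ ∑_{ij} h_{ij}(X_r) ∑_k σ^{ik}_r σ^{jk}_r`,

is written (`cell_error_eq`) as the sum of: the frozen-coefficient differences for `g_i bⁱ` and
for `h_{ij} σ^{ik}σ^{jk}`, the drift × drift and drift × martingale second-order terms, and the
Taylor remainder — the martingale terms having been evaluated by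
`integral_mul_martingalePart_eq_zero` / `integral_mul_martingalePart_mul_martingalePart`.
No definition, no sorry, standard axioms.  RECORD-rung plumbing (R3); the Yang–Mills mass gap is
NOT proved.
-/

set_option autoImplicit false

noncomputable section

namespace Summit.QuantumFields.YangMills.Theorems.ColdStartUniversality

open MeasureTheory ProbabilityTheory Filter Finset
open scoped NNReal ENNReal Topology
open Literature.Probability.Process

section Vec

variable {Ω : Type*} {mΩ : MeasurableSpace Ω} {P : Measure Ω} [IsProbabilityMeasure P] {d : ℕ}
  {W : ℝ≥0 → Ω → (Fin d → ℝ)} {ι : Type} [Fintype ι]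
  {X : ℝ≥0 → Ω → (ι → ℝ)} {b : ι → ℝ≥0 → Ω → ℝ} {σ J : ι → Fin d → ℝ≥0 → Ω → ℝ} {M : ℝ}
  {f : (ι → ℝ) → ℝ} {g : ι → (ι → ℝ) → ℝ} {h : ι → ι → (ι → ℝ) → ℝ} {Cf : ℝ}
  {u v : ℝ≥0} {Z : Ω → ℝ} {C : ℝ}

/-- **Taylor decomposition of the one-cell error.**  With `Aᵢ = ∫_{(u,v]} bⁱ dr`,
`Nᵢ = ∑_k (J_{ik}(v) - J_{ik}(u))`, `Y = X_u`, `Δᵢ = X_vⁱ - X_uⁱ (= Aᵢ + Nᵢ a.s.)` and the Taylor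
remainder `R = f(X_v) - f(X_u) - ∑ gᵢ(Y)Δᵢ - ½ ∑ hᵢⱼ(Y)ΔᵢΔⱼ`:
`E[Z(f(X_v) - f(X_u))] - E[Z ∫ Lf] = ∑ᵢ (E[Z gᵢ(Y) Aᵢ] - E[Z ∫ gᵢ(X_r) bⁱ]) +
  ½ ∑ᵢⱼ ∑_k (E[Z hᵢⱼ(Y) ∫ σ^{ik}σ^{jk}] - E[Z ∫ hᵢⱼ(X_r) σ^{ik}σ^{jk}]) +
  ½ ∑ᵢⱼ E[Z hᵢⱼ(Y) (AᵢAⱼ + AᵢNⱼ + NᵢAⱼ)] + E[Z R]`. [folklore] -/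
theorem cell_error_eq (hW : IsBrownianVec W P)
    (hb : ∀ i, IsStronglyProgressive hW.natFiltration (b i))
    (hσ : ∀ i k, IsStronglyProgressive hW.natFiltration (σ i k))
    (hbM : ∀ i r ω, |b i r ω| ≤ M) (hσM : ∀ i k r ω, |σ i k r ω| ≤ M)
    (hJ : ∀ i k, IsItoIntegral (σ i k) (fun r ω => W r ω k) (J i k) hW.natFiltration P)
    (hXm : ∀ i, Measurable fun p : Ω × ℝ ↦ X p.2.toNNReal p.1 i)
    (hXa : ∀ i t, StronglyMeasurable[hW.natFiltration t] (fun ω ↦ X t ω i))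
    (hXeq : ∀ i, ∀ᵐ ω ∂P, ∀ t, X t ω i = X 0 ω i + (∫ r in (0 : ℝ)..t, b i r.toNNReal ω) + ∑ k, J i k t ω)
    (hfc : Continuous f) (hgc : ∀ i, Continuous (g i)) (hhc : ∀ i j, Continuous (h i j))
    (hfB : ∀ y, |f y| ≤ Cf) (hgB : ∀ i y, |g i y| ≤ Cf) (hhB : ∀ i j y, |h i j y| ≤ Cf)
    (huv : u ≤ v) (hZ : StronglyMeasurable[hW.natFiltration u] Z) (hC : ∀ ω, |Z ω| ≤ C) :
    ∫ ω, Z ω * (f (X v ω) - f (X u ω)) ∂P -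
      ∫ ω, Z ω * (∫ r in Set.Ioc (u : ℝ) v, (∑ i, g i (X r.toNNReal ω) * b i r.toNNReal ω +
        (1 / 2) * ∑ i, ∑ j, h i j (X r.toNNReal ω) * ∑ k, σ i k r.toNNReal ω * σ j k r.toNNReal ω)) ∂P =
    (∑ i, (∫ ω, Z ω * g i (X u ω) * (∫ r in Set.Ioc (u : ℝ) v, b i r.toNNReal ω) ∂P -
        ∫ ω, Z ω * (∫ r in Set.Ioc (u : ℝ) v, g i (X r.toNNReal ω) * b i r.toNNReal ω) ∂P)) +
    (1 / 2) * (∑ i, ∑ j, ∑ k,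
      (∫ ω, Z ω * h i j (X u ω) * (∫ r in Set.Ioc (u : ℝ) v, σ i k r.toNNReal ω * σ j k r.toNNReal ω) ∂P -
        ∫ ω, Z ω * (∫ r in Set.Ioc (u : ℝ) v,
          h i j (X r.toNNReal ω) * (σ i k r.toNNReal ω * σ j k r.toNNReal ω)) ∂P)) +
    (1 / 2) * (∑ i, ∑ j, ∫ ω, Z ω * h i j (X u ω) *
      ((∫ r in Set.Ioc (u : ℝ) v, b i r.toNNReal ω) * (∫ r in Set.Ioc (u : ℝ) v, b j r.toNNReal ω) +
       (∫ r in Set.Ioc (u : ℝ) v, b i r.toNNReal ω) * (∑ k, (J j k v ω - J j k u ω)) +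
       (∑ k, (J i k v ω - J i k u ω)) * (∫ r in Set.Ioc (u : ℝ) v, b j r.toNNReal ω)) ∂P) +
    ∫ ω, Z ω * (f (X v ω) - f (X u ω) - ∑ i, g i (X u ω) * (X v ω i - X u ω i) -
      (1 / 2) * ∑ i, ∑ j, h i j (X u ω) * ((X v ω i - X u ω i) * (X v ω j - X u ω j))) ∂P := by
  classical
  -- constants and measurability
  obtain ⟨ω₀, -⟩ := nonempty_of_measure_ne_zero (μ := P) (s := Set.univ)
    (by rw [measure_univ]; exact one_ne_zero)
  have hC0 : 0 ≤ C := (abs_nonneg _).trans (hC ω₀)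
  have hCf0 : 0 ≤ Cf := (abs_nonneg _).trans (hfB (X u ω₀))
  have hbm : ∀ i, Measurable fun p : Ω × ℝ ↦ b i p.2.toNNReal p.1 := fun i ↦
    measurable_toNNReal_of_isStronglyProgressive (hb i)
  have hσm : ∀ i k, Measurable fun p : Ω × ℝ ↦ σ i k p.2.toNNReal p.1 := fun i k ↦
    measurable_toNNReal_of_isStronglyProgressive (hσ i k)
  have hXvec : Measurable fun p : Ω × ℝ ↦ X p.2.toNNReal p.1 := measurable_pi_lambda _ hXm
  have hXt : ∀ (t : ℝ≥0), Measurable (X t) := fun t ↦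
    measurable_pi_lambda _ fun i ↦ ((hXa i t).mono (hW.natFiltration.le t)).measurable
  have hXum : Measurable[hW.natFiltration u] (X u) :=
    @measurable_pi_lambda Ω ι (fun _ ↦ ℝ) (hW.natFiltration u) _ (X u) (fun i ↦ (hXa i u).measurable)
  have hZm : AEStronglyMeasurable Z P := (hZ.mono (hW.natFiltration.le u)).aestronglyMeasurable
  have hZb : ∀ᵐ ω ∂P, ‖Z ω‖ ≤ C := ae_of_all _ fun ω ↦ by simpa [Real.norm_eq_abs] using hC ω
  set δ : ℝ := (v : ℝ) - u with hδ
  have hδ0 : 0 ≤ δ := sub_nonneg.2 (NNReal.coe_le_coe.2 huv)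
  haveI hνfin : IsFiniteMeasure (volume.restrict (Set.Ioc (u : ℝ) v)) :=
    ⟨by rw [Measure.restrict_apply_univ, Real.volume_Ioc]; exact ENNReal.ofReal_lt_top⟩
  -- generic integrability of bounded measurable functions
  have hbddI : ∀ {φ : Ω → ℝ} {K : ℝ}, AEStronglyMeasurable φ P → (∀ ω, |φ ω| ≤ K) → Integrable φ P :=
    fun {φ K} hφ hK ↦ (integrable_const K).mono' hφ (ae_of_all _ fun ω ↦ by
      rw [Real.norm_eq_abs]; exact hK ω)
  have hbddIν : ∀ {φ : ℝ → ℝ} {K : ℝ}, Measurable φ → (∀ r, |φ r| ≤ K) →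
      Integrable φ (volume.restrict (Set.Ioc (u : ℝ) v)) :=
    fun {φ K} hφ hK ↦ (integrable_const K).mono' hφ.aestronglyMeasurable (ae_of_all _ fun r ↦ by
      rw [Real.norm_eq_abs]; exact hK r)
  -- the cell quantities
  set A : ι → Ω → ℝ := fun i ω ↦ ∫ r in Set.Ioc (u : ℝ) v, b i r.toNNReal ω with hA
  set N : ι → Ω → ℝ := fun i ω ↦ ∑ k, (J i k v ω - J i k u ω) with hN
  set Δ : ι → Ω → ℝ := fun i ω ↦ X v ω i - X u ω i with hΔ
  have hAb : ∀ i ω, |A i ω| ≤ M * δ := fun i ω ↦ abs_setIntegral_Ioc_le (hbM i) huv ω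
  have hAm : ∀ i, AEStronglyMeasurable (A i) P := fun i ↦ aestronglyMeasurable_setIntegral_Ioc (hbm i)
  have hB := fun k ↦ martingale_coord hW k
  have hBsq := fun k ↦ martingale_coord_sq_sub hW k
  have hB2 := fun k (r : ℝ≥0) ↦ memLp_two_coord hW r k
  have hBc := fun k ↦ continuous_coord hW k
  have hJ2 : ∀ i k (r : ℝ≥0), MemLp (J i k r) 2 P := fun i k r ↦
    IsItoIntegral.memLp_two (hB k) (hBsq k) (hB2 k) (hBc k) (hσ i k) (sqErr_ne_top_of_bdd (hσM i k))
      (hJ i k) r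
  have hN2 : ∀ i, MemLp (N i) 2 P := fun i ↦ memLp_finsetSum _ fun k _ ↦ (hJ2 i k v).sub (hJ2 i k u)
  have hΔmom := fun i ↦ incr_moments (x := fun t ω ↦ X t ω i) hW (hb i) (hσ i) (hbM i) (hσM i) (hJ i)
    (hXeq i) huv
  have hΔ4 : ∀ i, MemLp (Δ i) 4 P := fun i ↦ (hΔmom i).1
  have hΔ2 : ∀ i, MemLp (Δ i) 2 P := fun i ↦ (hΔ4 i).mono_exponent (by norm_num)
  have hA2 : ∀ i, MemLp (A i) 2 P := fun i ↦
    (memLp_const (M * δ)).of_le_mul (c := 1) (hAm i) (ae_of_all _ fun ω ↦ by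
      rw [Real.norm_eq_abs, Real.norm_eq_abs, one_mul,
        abs_of_nonneg ((abs_nonneg _).trans (hAb i ω))]; exact hAb i ω)
  have hae : ∀ i, (Δ i) =ᵐ[P] fun ω ↦ A i ω + N i ω := fun i ↦
    incr_eq_ae (x := fun t ω ↦ X t ω i) (hbm i) (hbM i) (hXeq i) huv
  -- the frozen weights
  have hgY : ∀ i, StronglyMeasurable[hW.natFiltration u] (fun ω ↦ Z ω * g i (X u ω)) := fun i ↦
    hZ.mul ((hgc i).measurable.comp hXum).stronglyMeasurable
  have hhY : ∀ i j, StronglyMeasurable[hW.natFiltration u] (fun ω ↦ Z ω * h i j (X u ω)) := fun i j ↦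
    hZ.mul ((hhc i j).measurable.comp hXum).stronglyMeasurable
  have hgYb : ∀ i ω, |Z ω * g i (X u ω)| ≤ C * Cf := fun i ω ↦ by
    rw [abs_mul]; exact mul_le_mul (hC ω) (hgB i _) (abs_nonneg _) hC0
  have hhYb : ∀ i j ω, |Z ω * h i j (X u ω)| ≤ C * Cf := fun i j ω ↦ by
    rw [abs_mul]; exact mul_le_mul (hC ω) (hhB i j _) (abs_nonneg _) hC0
  have hgYm : ∀ i, AEStronglyMeasurable (fun ω ↦ Z ω * g i (X u ω)) P := fun i ↦
    ((hgY i).mono (hW.natFiltration.le u)).aestronglyMeasurable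
  have hhYm : ∀ i j, AEStronglyMeasurable (fun ω ↦ Z ω * h i j (X u ω)) P := fun i j ↦
    ((hhY i j).mono (hW.natFiltration.le u)).aestronglyMeasurable
  have hgY2 : ∀ i, MemLp (fun ω ↦ Z ω * g i (X u ω)) 2 P := fun i ↦ by
    have h2 : MemLp (fun ω ↦ Z ω * g i (X u ω) * 1) 2 P := memLp_two_bdd_mul (hgYm i) (hgYb i) (memLp_const 1)
    simpa using h2
  have hhY2 : ∀ i j, MemLp (fun ω ↦ Z ω * h i j (X u ω)) 2 P := fun i j ↦ by
    have h2 : MemLp (fun ω ↦ Z ω * h i j (X u ω) * 1) 2 P :=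
      memLp_two_bdd_mul (hhYm i j) (hhYb i j) (memLp_const 1)
    simpa using h2
  -- Step 1: first order, `E[Z gᵢ(Y) Δᵢ] = E[Z gᵢ(Y) Aᵢ]`
  have h1 : ∀ i, ∫ ω, Z ω * g i (X u ω) * Δ i ω ∂P = ∫ ω, Z ω * g i (X u ω) * A i ω ∂P := by
    intro i
    have e : ∫ ω, Z ω * g i (X u ω) * Δ i ω ∂P = ∫ ω, (Z ω * g i (X u ω) * A i ω +
        Z ω * g i (X u ω) * N i ω) ∂P := by
      refine integral_congr_ae ?_
      filter_upwards [hae i] with ω hω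
      rw [hω]; ring
    have i1 : Integrable (fun ω ↦ Z ω * g i (X u ω) * A i ω) P := (hgY2 i).integrable_mul (hA2 i)
    have i2 : Integrable (fun ω ↦ Z ω * g i (X u ω) * N i ω) P := (hgY2 i).integrable_mul (hN2 i)
    rw [e, integral_add i1 i2]
    have h0 : ∫ ω, Z ω * g i (X u ω) * N i ω ∂P = 0 := by
      have := integral_mul_martingalePart_eq_zero hW (hσ i) (hσM i) (hJ i) huv (hgY i) (hgYb i)
      simpa only [hN] using this
    rw [h0, add_zero]
  -- Step 2: second order
  have h2 : ∀ i j, ∫ ω, Z ω * h i j (X u ω) * (Δ i ω * Δ j ω) ∂P =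
      ∫ ω, Z ω * h i j (X u ω) * (A i ω * A j ω + A i ω * N j ω + N i ω * A j ω) ∂P +
      ∑ k, ∫ ω, Z ω * h i j (X u ω) *
        (∫ r in Set.Ioc (u : ℝ) v, σ i k r.toNNReal ω * σ j k r.toNNReal ω) ∂P := by
    intro i j
    have e : ∫ ω, Z ω * h i j (X u ω) * (Δ i ω * Δ j ω) ∂P =
        ∫ ω, (Z ω * h i j (X u ω) * (A i ω * A j ω + A i ω * N j ω + N i ω * A j ω) +
          Z ω * h i j (X u ω) * (N i ω * N j ω)) ∂P := by
      refine integral_congr_ae ?_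
      filter_upwards [hae i, hae j] with ω hωi hωj
      rw [hωi, hωj]; ring
    have hZhb : ∀ᵐ ω ∂P, ‖Z ω * h i j (X u ω)‖ ≤ C * Cf :=
      ae_of_all _ fun ω ↦ by simpa [Real.norm_eq_abs] using hhYb i j ω
    have iAiAj : Integrable (fun ω ↦ A i ω * A j ω) P := (hA2 i).integrable_mul (hA2 j)
    have iAiNj : Integrable (fun ω ↦ A i ω * N j ω) P := (hA2 i).integrable_mul (hN2 j)
    have iNiAj : Integrable (fun ω ↦ N i ω * A j ω) P := (hN2 i).integrable_mul (hA2 j)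
    have iNiNj : Integrable (fun ω ↦ N i ω * N j ω) P := (hN2 i).integrable_mul (hN2 j)
    have i0 : Integrable (fun ω ↦ A i ω * A j ω + A i ω * N j ω + N i ω * A j ω) P :=
      (iAiAj.add iAiNj).add iNiAj
    have iAA : Integrable (fun ω ↦ Z ω * h i j (X u ω) * (A i ω * A j ω + A i ω * N j ω + N i ω * A j ω)) P :=
      i0.bdd_mul (hhYm i j) hZhb
    have iNN : Integrable (fun ω ↦ Z ω * h i j (X u ω) * (N i ω * N j ω)) P :=
      iNiNj.bdd_mul (hhYm i j) hZhb
    rw [e, integral_add iAA iNN]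
    congr 1
    have := integral_mul_martingalePart_mul_martingalePart hW (hσ i) (hσM i) (hJ i) (hσ j) (hσM j) (hJ j)
      huv (hhY i j) (hhYb i j)
    simpa only [hN] using this
  -- Step 3: the Taylor split of the left-hand side
  set R : Ω → ℝ := fun ω ↦ f (X v ω) - f (X u ω) - ∑ i, g i (X u ω) * (X v ω i - X u ω i) -
    (1 / 2) * ∑ i, ∑ j, h i j (X u ω) * ((X v ω i - X u ω i) * (X v ω j - X u ω j)) with hR
  have iLin : ∀ i, Integrable (fun ω ↦ Z ω * g i (X u ω) * Δ i ω) P := fun i ↦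
    (hgY2 i).integrable_mul (hΔ2 i)
  have iQuad : ∀ i j, Integrable (fun ω ↦ Z ω * h i j (X u ω) * (Δ i ω * Δ j ω)) P := fun i j ↦ by
    have i0 : Integrable (fun ω ↦ Δ i ω * Δ j ω) P := (hΔ2 i).integrable_mul (hΔ2 j)
    exact i0.bdd_mul (hhYm i j) (ae_of_all _ fun ω ↦ by simpa [Real.norm_eq_abs] using hhYb i j ω)
  have iF : Integrable (fun ω ↦ Z ω * (f (X v ω) - f (X u ω))) P :=
    hbddI (hZm.mul ((hfc.measurable.comp (hXt v)).aestronglyMeasurable.sub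
      (hfc.measurable.comp (hXt u)).aestronglyMeasurable)) (K := C * (Cf + Cf)) fun ω ↦ by
        rw [abs_mul]
        exact mul_le_mul (hC ω) ((abs_sub _ _).trans (add_le_add (hfB _) (hfB _))) (abs_nonneg _) hC0
  have iLinS : Integrable (fun ω ↦ ∑ i, Z ω * g i (X u ω) * Δ i ω) P := integrable_finsetSum _ fun i _ ↦ iLin i
  have iQuadS : Integrable (fun ω ↦ ∑ i, ∑ j, Z ω * h i j (X u ω) * (Δ i ω * Δ j ω)) P :=
    integrable_finsetSum _ fun i _ ↦ integrable_finsetSum _ fun j _ ↦ iQuad i j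
  have hsplit : ∀ ω, Z ω * (f (X v ω) - f (X u ω)) =
      (∑ i, Z ω * g i (X u ω) * Δ i ω) + (1 / 2) * (∑ i, ∑ j, Z ω * h i j (X u ω) * (Δ i ω * Δ j ω)) +
        Z ω * R ω := by
    intro ω
    have e1 : ∑ i, Z ω * g i (X u ω) * Δ i ω = Z ω * ∑ i, g i (X u ω) * (X v ω i - X u ω i) := by
      rw [mul_sum]
      exact sum_congr rfl fun i _ ↦ by simp only [hΔ]; ring
    have e2 : ∑ i, ∑ j, Z ω * h i j (X u ω) * (Δ i ω * Δ j ω) =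
        Z ω * ∑ i, ∑ j, h i j (X u ω) * ((X v ω i - X u ω i) * (X v ω j - X u ω j)) := by
      rw [mul_sum]
      refine sum_congr rfl fun i _ ↦ ?_
      rw [mul_sum]
      exact sum_congr rfl fun j _ ↦ by simp only [hΔ]; ring
    rw [e1, e2, hR]
    ring
  have iR : Integrable (fun ω ↦ Z ω * R ω) P := by
    have : (fun ω ↦ Z ω * R ω) = fun ω ↦ Z ω * (f (X v ω) - f (X u ω)) -
        (∑ i, Z ω * g i (X u ω) * Δ i ω) - (1 / 2) * (∑ i, ∑ j, Z ω * h i j (X u ω) * (Δ i ω * Δ j ω)) := by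
      funext ω; rw [hsplit ω]; ring
    rw [this]
    exact (iF.sub iLinS).sub (iQuadS.const_mul _)
  have hLHS : ∫ ω, Z ω * (f (X v ω) - f (X u ω)) ∂P =
      (∑ i, ∫ ω, Z ω * g i (X u ω) * A i ω ∂P) +
      (1 / 2) * (∑ i, ∑ j, (∫ ω, Z ω * h i j (X u ω) * (A i ω * A j ω + A i ω * N j ω + N i ω * A j ω) ∂P +
        ∑ k, ∫ ω, Z ω * h i j (X u ω) *
          (∫ r in Set.Ioc (u : ℝ) v, σ i k r.toNNReal ω * σ j k r.toNNReal ω) ∂P)) +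
      ∫ ω, Z ω * R ω ∂P := by
    have iQ' : Integrable (fun ω ↦ (1 / 2) * (∑ i, ∑ j, Z ω * h i j (X u ω) * (Δ i ω * Δ j ω))) P :=
      iQuadS.const_mul _
    have iLQ : Integrable (fun ω ↦ (∑ i, Z ω * g i (X u ω) * Δ i ω) +
        (1 / 2) * (∑ i, ∑ j, Z ω * h i j (X u ω) * (Δ i ω * Δ j ω))) P := iLinS.add iQ'
    rw [integral_congr_ae (ae_of_all _ hsplit), integral_add iLQ iR,
      integral_add iLinS iQ', integral_const_mul,
      integral_finsetSum _ fun i _ ↦ iLin i,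
      integral_finsetSum _ fun i _ ↦ integrable_finsetSum _ fun j _ ↦ iQuad i j]
    simp_rw [integral_finsetSum _ fun j _ ↦ iQuad _ j, h1, h2]
  -- Step 4: the target splits
  have hGm : ∀ i, Measurable fun p : Ω × ℝ ↦ g i (X p.2.toNNReal p.1) * b i p.2.toNNReal p.1 := fun i ↦
    ((hgc i).measurable.comp hXvec).mul (hbm i)
  have hHm : ∀ i j k, Measurable fun p : Ω × ℝ ↦
      h i j (X p.2.toNNReal p.1) * (σ i k p.2.toNNReal p.1 * σ j k p.2.toNNReal p.1) := fun i j k ↦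
    ((hhc i j).measurable.comp hXvec).mul ((hσm i k).mul (hσm j k))
  have hGb : ∀ i ω (r : ℝ), |g i (X r.toNNReal ω) * b i r.toNNReal ω| ≤ Cf * M := fun i ω r ↦ by
    rw [abs_mul]; exact mul_le_mul (hgB i _) (hbM i _ _) (abs_nonneg _) hCf0
  have hHb : ∀ i j k ω (r : ℝ), |h i j (X r.toNNReal ω) * (σ i k r.toNNReal ω * σ j k r.toNNReal ω)| ≤
      Cf * (M * M) := fun i j k ω r ↦ by
    have hM0 : 0 ≤ M := (abs_nonneg _).trans (hσM i k 0 ω₀)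
    rw [abs_mul, abs_mul]
    exact mul_le_mul (hhB i j _) (mul_le_mul (hσM i k _ _) (hσM j k _ _) (abs_nonneg _) hM0)
      (mul_nonneg (abs_nonneg _) (abs_nonneg _)) hCf0
  have iGν : ∀ i ω, Integrable (fun r : ℝ ↦ g i (X r.toNNReal ω) * b i r.toNNReal ω)
      (volume.restrict (Set.Ioc (u : ℝ) v)) := fun i ω ↦
    hbddIν ((hGm i).comp measurable_prodMk_left) (hGb i ω)
  have iHν : ∀ i j k ω, Integrable (fun r : ℝ ↦
      h i j (X r.toNNReal ω) * (σ i k r.toNNReal ω * σ j k r.toNNReal ω))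
      (volume.restrict (Set.Ioc (u : ℝ) v)) := fun i j k ω ↦
    hbddIν ((hHm i j k).comp measurable_prodMk_left) (hHb i j k ω)
  have hpath : ∀ ω, (∫ r in Set.Ioc (u : ℝ) v, (∑ i, g i (X r.toNNReal ω) * b i r.toNNReal ω +
      (1 / 2) * ∑ i, ∑ j, h i j (X r.toNNReal ω) * ∑ k, σ i k r.toNNReal ω * σ j k r.toNNReal ω)) =
      (∑ i, ∫ r in Set.Ioc (u : ℝ) v, g i (X r.toNNReal ω) * b i r.toNNReal ω) +
      (1 / 2) * ∑ i, ∑ j, ∑ k, ∫ r in Set.Ioc (u : ℝ) v,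
        h i j (X r.toNNReal ω) * (σ i k r.toNNReal ω * σ j k r.toNNReal ω) := by
    intro ω
    have hmul : ∀ r : ℝ, (∑ i, ∑ j, h i j (X r.toNNReal ω) * ∑ k, σ i k r.toNNReal ω * σ j k r.toNNReal ω) =
        ∑ i, ∑ j, ∑ k, h i j (X r.toNNReal ω) * (σ i k r.toNNReal ω * σ j k r.toNNReal ω) := fun r ↦
      sum_congr rfl fun i _ ↦ sum_congr rfl fun j _ ↦ mul_sum _ _ _
    simp_rw [hmul]
    have iS1 : Integrable (fun r : ℝ ↦ ∑ i, g i (X r.toNNReal ω) * b i r.toNNReal ω)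
        (volume.restrict (Set.Ioc (u : ℝ) v)) :=
      integrable_finsetSum _ fun i _ ↦ iGν i ω
    have iS2 : Integrable (fun r : ℝ ↦ ∑ i, ∑ j, ∑ k,
        h i j (X r.toNNReal ω) * (σ i k r.toNNReal ω * σ j k r.toNNReal ω))
        (volume.restrict (Set.Ioc (u : ℝ) v)) :=
      integrable_finsetSum _ fun i _ ↦ integrable_finsetSum _ fun j _ ↦
        integrable_finsetSum _ fun k _ ↦ iHν i j k ω
    have iS2' : Integrable (fun r : ℝ ↦ (1 / 2) * ∑ i, ∑ j, ∑ k,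
        h i j (X r.toNNReal ω) * (σ i k r.toNNReal ω * σ j k r.toNNReal ω))
        (volume.restrict (Set.Ioc (u : ℝ) v)) := iS2.const_mul _
    rw [integral_add iS1 iS2', integral_const_mul, integral_finsetSum _ fun i _ ↦ iGν i ω,
      integral_finsetSum _ fun i _ ↦ integrable_finsetSum _ fun j _ ↦
        integrable_finsetSum _ fun k _ ↦ iHν i j k ω]
    simp_rw [integral_finsetSum _ fun j _ ↦ integrable_finsetSum _ fun k _ ↦ iHν _ j k ω,
      integral_finsetSum _ fun k _ ↦ iHν _ _ k ω]
  -- integrability in `ω` of the pathwise time integrals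
  have hTgm : ∀ i, AEStronglyMeasurable (fun ω ↦ ∫ r in Set.Ioc (u : ℝ) v,
      g i (X r.toNNReal ω) * b i r.toNNReal ω) P := fun i ↦
    ((hGm i).stronglyMeasurable.integral_prod_right'
      (ν := volume.restrict (Set.Ioc (u : ℝ) v))).aestronglyMeasurable
  have hThm : ∀ i j k, AEStronglyMeasurable (fun ω ↦ ∫ r in Set.Ioc (u : ℝ) v,
      h i j (X r.toNNReal ω) * (σ i k r.toNNReal ω * σ j k r.toNNReal ω)) P := fun i j k ↦
    ((hHm i j k).stronglyMeasurable.integral_prod_right'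
      (ν := volume.restrict (Set.Ioc (u : ℝ) v))).aestronglyMeasurable
  have hνbound : ∀ {φ : ℝ → ℝ} {K : ℝ}, (∀ r, |φ r| ≤ K) → |∫ r in Set.Ioc (u : ℝ) v, φ r| ≤ K * δ := by
    intro φ K hK
    have hh := norm_setIntegral_le_of_norm_le_const (μ := volume) (s := Set.Ioc (u : ℝ) v) (f := φ)
      (C := K) (by rw [Real.volume_Ioc]; exact ENNReal.ofReal_lt_top) (fun r _ ↦ by
        rw [Real.norm_eq_abs]; exact hK r)
    rw [Real.volume_real_Ioc_of_le (NNReal.coe_le_coe.2 huv), Real.norm_eq_abs] at hh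
    exact hh
  have iTg : ∀ i, Integrable (fun ω ↦ Z ω * ∫ r in Set.Ioc (u : ℝ) v,
      g i (X r.toNNReal ω) * b i r.toNNReal ω) P := fun i ↦
    hbddI (hZm.mul (hTgm i)) (K := C * (Cf * M * δ)) fun ω ↦ by
      rw [abs_mul]; exact mul_le_mul (hC ω) (hνbound (hGb i ω)) (abs_nonneg _) hC0
  have iTh : ∀ i j k, Integrable (fun ω ↦ Z ω * ∫ r in Set.Ioc (u : ℝ) v,
      h i j (X r.toNNReal ω) * (σ i k r.toNNReal ω * σ j k r.toNNReal ω)) P := fun i j k ↦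
    hbddI (hZm.mul (hThm i j k)) (K := C * (Cf * (M * M) * δ)) fun ω ↦ by
      rw [abs_mul]; exact mul_le_mul (hC ω) (hνbound (hHb i j k ω)) (abs_nonneg _) hC0
  have hT : ∫ ω, Z ω * (∫ r in Set.Ioc (u : ℝ) v, (∑ i, g i (X r.toNNReal ω) * b i r.toNNReal ω +
      (1 / 2) * ∑ i, ∑ j, h i j (X r.toNNReal ω) * ∑ k, σ i k r.toNNReal ω * σ j k r.toNNReal ω)) ∂P =
      (∑ i, ∫ ω, Z ω * (∫ r in Set.Ioc (u : ℝ) v, g i (X r.toNNReal ω) * b i r.toNNReal ω) ∂P) +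
      (1 / 2) * ∑ i, ∑ j, ∑ k, ∫ ω, Z ω * (∫ r in Set.Ioc (u : ℝ) v,
        h i j (X r.toNNReal ω) * (σ i k r.toNNReal ω * σ j k r.toNNReal ω)) ∂P := by
    simp_rw [hpath]
    have e : ∀ ω, Z ω * ((∑ i, ∫ r in Set.Ioc (u : ℝ) v, g i (X r.toNNReal ω) * b i r.toNNReal ω) +
        (1 / 2) * ∑ i, ∑ j, ∑ k, ∫ r in Set.Ioc (u : ℝ) v,
          h i j (X r.toNNReal ω) * (σ i k r.toNNReal ω * σ j k r.toNNReal ω)) =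
        (∑ i, Z ω * ∫ r in Set.Ioc (u : ℝ) v, g i (X r.toNNReal ω) * b i r.toNNReal ω) +
        (1 / 2) * ∑ i, ∑ j, ∑ k, Z ω * ∫ r in Set.Ioc (u : ℝ) v,
          h i j (X r.toNNReal ω) * (σ i k r.toNNReal ω * σ j k r.toNNReal ω) := by
      intro ω; simp only [mul_add, mul_sum]; ring
    simp_rw [e]
    have iS1 : Integrable (fun ω ↦ ∑ i, Z ω * ∫ r in Set.Ioc (u : ℝ) v,
        g i (X r.toNNReal ω) * b i r.toNNReal ω) P := integrable_finsetSum _ fun i _ ↦ iTg i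
    have iS2 : Integrable (fun ω ↦ ∑ i, ∑ j, ∑ k, Z ω * ∫ r in Set.Ioc (u : ℝ) v,
        h i j (X r.toNNReal ω) * (σ i k r.toNNReal ω * σ j k r.toNNReal ω)) P :=
      integrable_finsetSum _ fun i _ ↦ integrable_finsetSum _ fun j _ ↦
        integrable_finsetSum _ fun k _ ↦ iTh i j k
    have iS2' : Integrable (fun ω ↦ (1 / 2) * ∑ i, ∑ j, ∑ k, Z ω * ∫ r in Set.Ioc (u : ℝ) v,
        h i j (X r.toNNReal ω) * (σ i k r.toNNReal ω * σ j k r.toNNReal ω)) P := iS2.const_mul _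
    rw [integral_add iS1 iS2', integral_const_mul, integral_finsetSum _ fun i _ ↦ iTg i,
      integral_finsetSum _ fun i _ ↦ integrable_finsetSum _ fun j _ ↦
        integrable_finsetSum _ fun k _ ↦ iTh i j k]
    simp_rw [integral_finsetSum _ fun j _ ↦ integrable_finsetSum _ fun k _ ↦ iTh _ j k,
      integral_finsetSum _ fun k _ ↦ iTh _ _ k]
  -- Step 5: combine
  rw [hLHS, hT]
  simp only [hA, hN, hR, sum_add_distrib, sum_sub_distrib]
  ring

end Vec

end Summit.QuantumFields.YangMills.Theorems.ColdStartUniversality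

end
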